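import Mathlib.Topology.Order.ProjIcc
import Mathlib.Topology.Order.OrderClosed
import Mathlib.Geometry.Manifold.SmoothEmbedding
import Literature.Topology.FourManifolds.MMSWRasmussen
import HarnessLib

/-!
# The Manolescu–Marengon–Sarkar–Willis invariants: the theorems, and the bundled invariant

Companion of `Literature/Topology/FourManifolds/MMSWRasmussen.lean` (definition item
`defn-MMSWRasmussen`, route `SmoothPoincare4/DottedCircleRasmussen`, items `DcrRasmussenWitness`,
`DcrGfgmw`, `DcrAdjunction`, `DcrCalibration`).  That file DEFINES, for a knot `K` in the explicit
model `M_r = ∂D_r ⊂ ℝ⁴` of `#ʳ(S¹ × S²)`, the predicates `MMSW.HasSMinus r K s` (`s₋(K) = s`) and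
`MMSW.HasSPlus r K s` (`s₊(K) = s`) of [MMSW, Def. 8.1] through the finite approximation theorem.
This file adds:

* PROVED structural facts: null-homology is transported along isotopies of model knots and by
  the model mirror `ρ`, hence `HasSMinus` / `HasSPlus` are isotopy invariants of the knot in `M_r`
  (`HasSMinus.of_isModelIsotopic`, `HasSPlus.of_isModelIsotopic`) — the part of [MMSW, Thm. 1.3]
  that is formal given the shape of the definition;
* the THEOREMS of [MMSW] about `s_±` of knots, as named facts (`def … : Prop`, cited):
  general position of knots w.r.t. the core circles (`exists_isModelIsotopic_wC_ne_zero`,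
  transversality), eventual constancy of `k ↦ s(D(k⃗))` (Thm. 1.4 = Thm. 3.3, Prop. 8.2 (i):
  `eventually_approxHasRasmussen`), independence of all choices (Thm. 1.3 = Thm. 3.4:
  `hasSMinus_unique`), `s₋ ≤ s₊` (Prop. 8.8, Thm. 1.15: `sMinus_le_sPlus`), and the two genus
  bounds of Thm. 1.15 / Lemma 8.19 in the case the route needs — KNOTS bounding DISCS:
  a null-homologous knot bounding a smooth proper disc in the `2`-handlebody filling
  `S⁴ ∖ D_r° ≅ ♮ʳ(B² × S²)` has `s₋ ≤ 0` (`sMinus_nonpos_of_isModelSliceDisc`, Lemma 8.19), one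
  bounding a smooth proper disc in the `1`-handlebody `D_r ≅ ♮ʳ(S¹ × B³)` has `s₊ ≤ 0`
  (`sPlus_nonpos_of_isInnerSliceDisc`, Thm. 8.16);
* their formal consequences: `existsUnique_hasSMinus`, `existsUnique_hasSPlus`, the mirror
  halves `0 ≤ s₊` resp. `0 ≤ s₋` of the two disc bounds (the model reflection `ρ` preserves
  `D_r` and its complement), so that a knot sliced in the complement satisfies the window
  `s₋(K) ≤ 0 ≤ s₊(K)` (`sMinus_nonpos_sPlus_nonneg_of_isModelSliceDisc`, the model form of the
  route's GFGMW lemma) and a knot sliced inside `D_r` has `s₋(K) = s₊(K) = 0`;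
* the disc predicates this needs: `MMSW.IsSliceDiscInComplement r K X e f` — word for word the
  disc clause of the route's items (`DcrGap`, …; cf. `Knot.IsSliceDiscIn` of `HomotopyBallSlice`,
  with the closed unit ball replaced by the model handlebody `D_r`), its model case
  `MMSW.IsModelSliceDisc r K f` (`X = ℝ⁴`, `e = id`) and `MMSW.IsInnerSliceDisc r K f`;
* the bundled notion `MMSWRasmussen r K`: the pair `(s₋(K), s₊(K))` WITH its certificates — a
  subsingleton (given `hasSMinus_unique`), inhabited exactly for null-homologous model knots
  (given the existence facts), with the mirror rule `s_±(ρK) = -s_∓(K)` (Prop. 8.8 (1)) and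
  isotopy invariance proved.

## Why both `s₋ ≤ 2g` and `-2g ≤ s₊` hold for surfaces in the complement of `D_r`

`W_r := S⁴ ∖ D_r°` is the `4`-ball `B_∞ = S⁴ ∖ D̂°` (`D̂ = {ĝ(z) + |w|² ≤ 1}`, `ĝ` the planar
potential with its poles capped, a `4`-ball containing `D_r`) with the `r` pieces
`T_j = D̂ ∩ {|w|² ≥ 1 - g(z), z near c_j} ≅ D² × D²` attached along the fibre circles
`{z = c_j, |w|² = 1 - ĝ(c_j)} ⊂ ∂D̂ ≅ S³`, which form an `r`-component unlink (fibres of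
`(z, w) ↦ z` over interior points bound disjoint meridian discs `{arg z = const}` of the
complementary solid torus), framed by the `z`-coordinate, i.e. `0`-framed: `W_r` is `B⁴` with `r`
`0`-framed `2`-handles along an unlink, `≅ ♮ʳ(B² × S²)` [Kirby1989, Ch. I §2], the second filling
of `M_r` of [MMSW, Def. 8.14].  The identification of `∂W_r = M_r` with MMSW's `∂(♮ʳ B² × S²)`
(Kirby diagram) differs from theirs by a self-diffeomorphism `χ` of `M_r`; composing with the
model reflection `ρ(z, w) = (z̄, w)` — which preserves `D_r`, hence `W_r` — if necessary, `χ` is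
orientation-preserving, under which `s_±` are invariant [MMSW, Thm. 2.8].  Hence Lemma 8.19
applies verbatim to discs in `W_r`: `s₋(K) ≤ 0`; and applying it to `ρ ∘ K`, which bounds the
reflected disc, gives `s₊(K) = -s₋(ρ ∘ K) ≥ 0` (proved below from the `s₋` statement).  For
`r = 0` both say: a slice knot has `s = 0`.

## What is NOT here (scope)

* Links (`ℓ ≥ 2`) and surfaces of genus `g > 0` / several components: [MMSW] Lemma 8.19 reads
  `s₋(L) ≤ 2g(Σ) + ℓ - 2σ + 1` and Thm. 1.15 `s_∓(L) ≤ 2g_{B²×S² / S¹×B³}(L) + ℓ - 1`; only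
  `ℓ = σ = 1`, `g = 0` is vendored (the tree's `Knot.IsSpanningSurfaceOfGenus` is tied to
  `S³ = ∂B⁴`).  `-- TODO(general form): genus-g spanning surfaces of model knots/links in W_r, D_r.`
* Thm. 1.6 (`s(F_p) = 1 - 2p`, a `2p`-component link), Thm. 1.14 (connected sums), Thm. 1.5 /
  Cor. 8.11 (cobordisms in `I × M_r`), the explicit threshold `k ≥ ⌈(n⁺_D + 2)/2⌉` of Thm. 1.4
  (only eventual constancy is stated, as in the definition of `HasSMinus`).
* No proofs of the [MMSW] theorems: they rest on Khovanov–Lee homology in `#ʳ(S¹ × S²)`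
  (Rozansky–Willis), absent from the tree.

## References

* C. Manolescu, M. Marengon, S. Sarkar, M. Willis, *A generalization of Rasmussen's invariant,
  with applications to surfaces in some four-manifolds*, Duke Math. J. 172 (2023) 231–311,
  arXiv:1910.08195: Thm. 1.3 (= 3.4), Thm. 1.4 (= 3.3), Thm. 2.8, Def. 8.1, Prop. 8.2, Prop. 8.8,
  Def. 8.13–8.14, Thm. 1.15 (= 8.16), Lemma 8.19, Lemma 8.20. [ManolescuMarengonSarkarWillis2023]
* R. Kirby, *The Topology of 4-Manifolds*, LNM 1374 (1989), Ch. I §2 (dotted circles,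
  `S¹ × B³ ↔ B² × S²`, `0`-framed unlink). [Kirby1989]
* M. Hirsch, *Differential Topology* (1976), Ch. 3 Thm. 2.4 and §8.1 Ex. 5 (transversality: a circle
  in a `3`-manifold is isotopic to one missing a given compact `1`-dimensional submanifold; isotopy
  extension, §8.1 Thm. 1.3). [Hirsch1976]
-/

open scoped Manifold ContDiff Topology ComplexConjugate
open Function Set

noncomputable section

namespace Literature.Topology.FourManifolds

/-- Local notation: `𝔼 n` is the model Euclidean space `EuclideanSpace ℝ (Fin n)`. -/
local notation "𝔼 " n:arg => EuclideanSpace ℝ (Fin n)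

/-- Local notation: `𝕊 n` is the unit sphere in `EuclideanSpace ℝ (Fin (n + 1))`. -/
local notation "𝕊 " n:arg => (Metric.sphere (0 : EuclideanSpace ℝ (Fin (n + 1))) 1)

/-- Local notation: `𝔻²` is the closed unit disc in `ℝ²`. -/
local notation "𝔻²" => Metric.closedBall (0 : EuclideanSpace ℝ (Fin 2)) 1

namespace MMSW

open Literature.AlgebraicTopology.Homotopy.HopfFibration (zC wC continuous_zC)

variable {r : ℕ}

/-! ## Null-homology is a property of the knot type -/

/-- The model mirror `ρ(z, w) = (z̄, w)` preserves null-homology: conjugate the null-homotopies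
(the hole centres are real). [folklore] -/
theorem IsNullHomologous.modelMirror_comp {K : 𝕊 1 → 𝔼 4} (h : IsNullHomologous r K) :
    IsNullHomologous r (modelMirror ∘ K) := by
  intro j
  obtain ⟨H, hH, hne, h0, c, h1⟩ := h j
  refine ⟨fun p ↦ conj (H p), Complex.continuous_conj.comp hH, fun p hp ↦ hne p ?_, fun t ↦ ?_,
    conj c, fun t ↦ ?_⟩
  · have hp' : conj (H p) = holeCentre r j := hp
    rw [← Complex.conj_conj (H p), hp', holeCentre, Complex.conj_ofReal]
  · show conj (H (0, t)) = zC (modelMirror (K t))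
    rw [h0 t, zC_modelMirror]
  · show conj (H (1, t)) = conj c
    rw [h1 t]

/-- Null-homology of `ρ ∘ K` and of `K` are equivalent (`ρ` is an involution). [folklore] -/
theorem isNullHomologous_modelMirror_comp_iff (K : 𝕊 1 → 𝔼 4) :
    IsNullHomologous r (modelMirror ∘ K) ↔ IsNullHomologous r K := by
  refine ⟨fun h ↦ ?_, IsNullHomologous.modelMirror_comp⟩
  have := h.modelMirror_comp
  rwa [← Function.comp_assoc, show modelMirror ∘ modelMirror = id from
    funext modelMirror_modelMirror, Function.id_comp] at this

/-- **Null-homology is transported along smooth isotopies of model knots**: the isotopy `H`,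
run backwards and projected to the `z`-plane, is a free homotopy from `z ∘ K'` to `z ∘ K` in
`ℂ ∖ {c_j}` (every `H_s` is a model knot, so the guard `1 ≤ |z - c_j|²` keeps it off the hole
centres); concatenate it with a null-homotopy of `z ∘ K`. [folklore] -/
theorem IsSmoothModelIsotopy.isNullHomologous {K K' : 𝕊 1 → 𝔼 4}
    (hiso : IsSmoothModelIsotopy r K K') (h : IsNullHomologous r K) : IsNullHomologous r K' := by
  obtain ⟨H, hH, hH0, hH1, hK⟩ := hiso
  intro j
  obtain ⟨G, hG, hGne, hG0, c, hG1⟩ := h j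
  -- first half: the isotopy backwards; second half: the given null-homotopy
  let A : unitInterval × (𝕊 1) → ℂ := fun p ↦ zC (H (1 - 2 * (p.1 : ℝ)) p.2)
  let B : unitInterval × (𝕊 1) → ℂ := fun p ↦
    G (Set.projIcc (0 : ℝ) 1 zero_le_one (2 * (p.1 : ℝ) - 1), p.2)
  have hA : Continuous A := by
    have h1 : Continuous fun p : unitInterval × (𝕊 1) ↦ ((1 - 2 * (p.1 : ℝ) : ℝ), p.2) :=
      (continuous_const.sub (continuous_const.mul
        (continuous_subtype_val.comp continuous_fst))).prodMk continuous_snd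
    exact continuous_zC.comp (hH.continuous.comp h1)
  have hB : Continuous B := by
    have h1 : Continuous fun p : unitInterval × (𝕊 1) ↦
        (Set.projIcc (0 : ℝ) 1 zero_le_one (2 * (p.1 : ℝ) - 1), p.2) :=
      (continuous_projIcc.comp ((continuous_const.mul
        (continuous_subtype_val.comp continuous_fst)).sub continuous_const)).prodMk
        continuous_snd
    exact hG.comp h1
  refine ⟨fun p ↦ if (p.1 : ℝ) ≤ 1 / 2 then A p else B p, ?_, ?_, ?_, c, ?_⟩
  · refine hA.if_le hB (continuous_subtype_val.comp continuous_fst) continuous_const ?_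
    rintro ⟨u, t⟩ (hu : (u : ℝ) = 1 / 2)
    simp only [A, B, hu]
    norm_num only
    rw [Set.projIcc_left, Set.Icc.mk_zero, hG0 t, hH0 0 le_rfl]
  · rintro ⟨u, t⟩
    by_cases hu : (u : ℝ) ≤ 1 / 2
    · simp only [hu, if_true, A]
      exact zC_ne_holeCentre ((hK _).mem t).1 j
    · simp only [hu, if_false, B]
      exact hGne _
  · intro t
    have h : ((0 : unitInterval) : ℝ) ≤ 1 / 2 := by norm_num
    show (if ((0 : unitInterval) : ℝ) ≤ 1 / 2 then A (0, t) else B (0, t)) = zC (K' t)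
    rw [if_pos h]
    show zC (H (1 - 2 * ((0 : unitInterval) : ℝ)) t) = zC (K' t)
    rw [Set.Icc.coe_zero, mul_zero, sub_zero, hH1 1 le_rfl]
  · intro t
    have h : ¬ ((1 : unitInterval) : ℝ) ≤ 1 / 2 := by norm_num
    show (if ((1 : unitInterval) : ℝ) ≤ 1 / 2 then A (1, t) else B (1, t)) = c
    rw [if_neg h]
    show G (Set.projIcc 0 1 zero_le_one (2 * ((1 : unitInterval) : ℝ) - 1), t) = c
    rw [Set.Icc.coe_one, mul_one, show (2 : ℝ) - 1 = 1 by norm_num, Set.projIcc_right,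
      Set.Icc.mk_one, hG1 t]

/-- Null-homology is transported along isotopy of model knots (chains of smooth isotopies).
[folklore] -/
theorem IsModelIsotopic.isNullHomologous {K K' : 𝕊 1 → 𝔼 4} (hiso : IsModelIsotopic r K K')
    (h : IsNullHomologous r K) : IsNullHomologous r K' := by
  induction hiso with
  | single h1 => exact h1.isNullHomologous h
  | tail _ h1 ih => exact h1.isNullHomologous ih

/-- Isotopic model knots are null-homologous together. [folklore] -/
theorem IsModelIsotopic.isNullHomologous_iff {K K' : 𝕊 1 → 𝔼 4} (hiso : IsModelIsotopic r K K') :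
    IsNullHomologous r K ↔ IsNullHomologous r K' :=
  ⟨hiso.isNullHomologous, hiso.symm.isNullHomologous⟩

/-! ## `s₋`, `s₊` are invariants of the knot type in `M_r` (the formal part of MMSW Thm. 1.3) -/

/-- **`s₋` is an isotopy invariant**: if `s₋(K) = s` and `K'` is isotopic to `K` in `M_r` then
`s₋(K') = s` — immediate from the shape of `HasSMinus` (an existential over isotopic
representatives) once null-homology is transported. [cite: ManolescuMarengonSarkarWillis2023, Thm. 1.3] -/
theorem HasSMinus.of_isModelIsotopic {K K' : 𝕊 1 → 𝔼 4} {s : ℤ} (h : HasSMinus r K s)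
    (hKK' : IsModelIsotopic r K K') : HasSMinus r K' s := by
  obtain ⟨h0, K'', hiso, hw, k₀, hk⟩ := h
  exact ⟨hKK'.isNullHomologous h0, K'', hKK'.symm.trans hiso, hw, k₀, hk⟩

/-- `s₋(K) = s ↔ s₋(K') = s` for isotopic model knots. [cite: ManolescuMarengonSarkarWillis2023, Thm. 1.3] -/
theorem IsModelIsotopic.hasSMinus_iff {K K' : 𝕊 1 → 𝔼 4} (hKK' : IsModelIsotopic r K K')
    (s : ℤ) : HasSMinus r K s ↔ HasSMinus r K' s :=
  ⟨fun h ↦ h.of_isModelIsotopic hKK', fun h ↦ h.of_isModelIsotopic hKK'.symm⟩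

/-- **`s₊` is an isotopy invariant** (mirror the isotopy). [cite: ManolescuMarengonSarkarWillis2023, Thm. 1.3] -/
theorem HasSPlus.of_isModelIsotopic {K K' : 𝕊 1 → 𝔼 4} {s : ℤ} (h : HasSPlus r K s)
    (hKK' : IsModelIsotopic r K K') : HasSPlus r K' s :=
  HasSMinus.of_isModelIsotopic h hKK'.modelMirror_comp

/-- `s₊(K) = s ↔ s₊(K') = s` for isotopic model knots. [cite: ManolescuMarengonSarkarWillis2023, Thm. 1.3] -/
theorem IsModelIsotopic.hasSPlus_iff {K K' : 𝕊 1 → 𝔼 4} (hKK' : IsModelIsotopic r K K')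
    (s : ℤ) : HasSPlus r K s ↔ HasSPlus r K' s :=
  ⟨fun h ↦ h.of_isModelIsotopic hKK', fun h ↦ h.of_isModelIsotopic hKK'.symm⟩

/-- `s₊` is only asserted of null-homologous knots. [cite: ManolescuMarengonSarkarWillis2023, Def. 8.1] -/
theorem HasSPlus.isNullHomologous {K : 𝕊 1 → 𝔼 4} {s : ℤ} (h : HasSPlus r K s) :
    IsNullHomologous r K :=
  (isNullHomologous_modelMirror_comp_iff K).1 (HasSMinus.isNullHomologous h)

/-- `s₊` is only asserted of model knots. [cite: ManolescuMarengonSarkarWillis2023, Def. 8.1] -/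
theorem HasSPlus.isModelKnot {K : 𝕊 1 → 𝔼 4} {s : ℤ} (h : HasSPlus r K s) : IsModelKnot r K :=
  (isModelKnot_modelMirror_comp_iff K).1 (HasSMinus.isModelKnot h)

/-! ## The theorems of Manolescu–Marengon–Sarkar–Willis (named facts) -/

/-- **General position w.r.t. the core circles.** Every model knot `K ⊂ M_r` is isotopic,
through model knots, to one missing the `r + 1` core circles `{w = 0}` of `M_r` (where the
standard picture `draw` is not defined): in the `3`-manifold `M_r` the embedded circle `K` is
approximated, in the strong `C^∞` topology, by an embedding transverse to — i.e., by dimensions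
`1 + 1 < 3`, disjoint from — the compact `1`-dimensional submanifold of cores (Hirsch (1976),
Ch. 3, Thm. 2.4), and `C^∞`-close embeddings of a compact manifold are isotopic (ibid., §8.1,
Exercise 5); an isotopy in `M_r ⊂ ℝ⁴`, reparametrised with collars, is an `IsSmoothModelIsotopy`.
[cite: Hirsch1976, Ch. 3 Thm. 2.4 and §8.1 Ex. 5] -/
def exists_isModelIsotopic_wC_ne_zero : Prop :=
  ∀ {r : ℕ} {K : 𝕊 1 → 𝔼 4} (_hK : IsModelKnot r K),
    ∃ K' : 𝕊 1 → 𝔼 4, IsModelIsotopic r K K' ∧ ∀ t, wC (K' t) ≠ 0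

/-- **Finite approximation / eventual constancy (MMSW Thm. 1.4 = Thm. 3.3, Prop. 8.2 (i)).**
For a null-homologous model knot `K ⊂ M_r` missing the core circles, the finite approximations
`D(k⃗) = finiteApprox r k K` (`k⃗ = (k, …, k)`) are smooth knots in `S³` whose ordinary Rasmussen
invariants are eventually constant: there are `s ∈ ℤ` and `k₀` with `s(D(k⃗)) = s` for all
`k ≥ k₀` (read through the tree's `Knot.HasRasmussenInvariant`, i.e. `ApproxHasRasmussen`).
In [MMSW]: `s(L) = s(D(k⃗))` for every `k ≥ ⌈(n⁺_D + 2)/2⌉`, `D` the standard diagram of `L`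
drawn by `draw` (made regular by a small isotopy, which moves each `D(k⃗)` by an isotopy of
`S³`); the assertion also packages the elementary facts that `draw ∘ σ^k` is a smooth embedding
of `M_r ∖ {cores}` into `ℝ³` and `toSphereThree` one of `ℝ³` into `S³`, and Rasmussen's theorem
that every knot in `S³` has an `s` (tree: `Knot.existsUnique_hasRasmussenInvariant`).
[cite: ManolescuMarengonSarkarWillis2023, Thm. 1.4 and Prop. 8.2 (i)] -/
def eventually_approxHasRasmussen : Prop :=
  ∀ {r : ℕ} {K : 𝕊 1 → 𝔼 4} (_hK : IsModelKnot r K) (_h0 : IsNullHomologous r K)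
    (_hw : ∀ t, wC (K t) ≠ 0), ∃ (s : ℤ) (k₀ : ℤ), ∀ k, k₀ ≤ k → ApproxHasRasmussen r k K s

/-- **Well-definedness (MMSW Thm. 1.3 = Thm. 3.4, with Def. 8.1 / Prop. 8.2 (i)).** The value
`s₋(K)` does not depend on the choices in `HasSMinus`: two isotopic core-missing representatives
`K'`, `K''` of the null-homologous knot `K ⊂ M_r` have standard diagrams `D'`, `D''` of the SAME
knot in `#ʳ(S¹ × S²)`, so the eventual values of `s(D'(k⃗))` and `s(D''(k⃗))` both equal `s(L)`
("if `D₁` and `D₂` are two diagrams for the same oriented null-homologous link `L` in `M_r` then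
`s(D₁) = s(D₂)`"), the eventual values being `s` of the diagrams by Thm. 1.4.
[cite: ManolescuMarengonSarkarWillis2023, Thm. 1.3 and Thm. 1.4] -/
def hasSMinus_unique : Prop :=
  ∀ {r : ℕ} {K : 𝕊 1 → 𝔼 4} {s s' : ℤ} (_h : HasSMinus r K s) (_h' : HasSMinus r K s'), s = s'

/-- **`s₋ ≤ s₊` (MMSW Prop. 8.8 (5); the first line of Thm. 1.15 = Thm. 8.16).** For a non-empty
null-homologous link `L ⊂ #ʳ(S¹ × S²)`, `s₋(L) ≤ s₊(L)`; here for knots: `s₋(K) = s` and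
`s₊(K) = s'` imply `s ≤ s'`. (For knots in `S³`, `s₋ = s₊ = s`; in `S¹ × S²` the positive
Whitehead knot has `s₋ = 0 < 2 = s₊`, [MMSW, Ex. 8.5].) [cite: ManolescuMarengonSarkarWillis2023, Prop. 8.8 (5) and Thm. 1.15] -/
def sMinus_le_sPlus : Prop :=
  ∀ {r : ℕ} {K : 𝕊 1 → 𝔼 4} {s s' : ℤ} (_h : HasSMinus r K s) (_h' : HasSPlus r K s'), s ≤ s'

/-! ### Consequences: existence and uniqueness of `s₋(K)`, `s₊(K)` -/

/-- **Existence of `s₋`**: every null-homologous model knot has an `s₋` (general position, then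
eventual constancy of the finite approximations). [cite: ManolescuMarengonSarkarWillis2023, Thm. 1.4 and Def. 8.1] -/
theorem exists_hasSMinus (hgp : exists_isModelIsotopic_wC_ne_zero)
    (hev : eventually_approxHasRasmussen) {K : 𝕊 1 → 𝔼 4} (hK : IsModelKnot r K)
    (h0 : IsNullHomologous r K) : ∃ s, HasSMinus r K s := by
  obtain ⟨K', hKK', hw⟩ := hgp hK
  obtain ⟨s, k₀, hk⟩ := hev hKK'.isModelKnot_right (hKK'.isNullHomologous h0) hw
  exact ⟨s, h0, K', hKK', hw, k₀, hk⟩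

/-- **`s₋(K)` is well defined (MMSW Thms. 1.3, 1.4, Def. 8.1)**: a null-homologous model knot
has exactly one `s` with `s₋(K) = s`. The name promised by the docstring of `HasSMinus`.
[cite: ManolescuMarengonSarkarWillis2023, Thm. 1.3 and Thm. 1.4] -/
theorem existsUnique_hasSMinus (hgp : exists_isModelIsotopic_wC_ne_zero)
    (hev : eventually_approxHasRasmussen) (huniq : hasSMinus_unique) {K : 𝕊 1 → 𝔼 4}
    (hK : IsModelKnot r K) (h0 : IsNullHomologous r K) : ∃! s, HasSMinus r K s := by
  obtain ⟨s, hs⟩ := exists_hasSMinus hgp hev hK h0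
  exact ⟨s, hs, fun s' hs' ↦ huniq hs' hs⟩

/-- Conversely, only null-homologous model knots have an `s₋`. [cite: ManolescuMarengonSarkarWillis2023, Def. 8.1] -/
theorem exists_hasSMinus_iff (hgp : exists_isModelIsotopic_wC_ne_zero)
    (hev : eventually_approxHasRasmussen) (K : 𝕊 1 → 𝔼 4) :
    (∃ s, HasSMinus r K s) ↔ IsModelKnot r K ∧ IsNullHomologous r K :=
  ⟨fun ⟨_, hs⟩ ↦ ⟨hs.isModelKnot, hs.isNullHomologous⟩,
    fun h ↦ exists_hasSMinus hgp hev h.1 h.2⟩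

/-- Uniqueness of `s₋(K)`, dot notation. [cite: ManolescuMarengonSarkarWillis2023, Thm. 1.3] -/
theorem HasSMinus.unique (huniq : hasSMinus_unique) {K : 𝕊 1 → 𝔼 4} {s s' : ℤ}
    (h : HasSMinus r K s) (h' : HasSMinus r K s') : s = s' :=
  huniq h h'

/-- Uniqueness of `s₊(K)` (mirror). [cite: ManolescuMarengonSarkarWillis2023, Thm. 1.3 and Def. 8.1] -/
theorem HasSPlus.unique (huniq : hasSMinus_unique) {K : 𝕊 1 → 𝔼 4} {s s' : ℤ}
    (h : HasSPlus r K s) (h' : HasSPlus r K s') : s = s' :=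
  neg_injective (huniq h h')

/-- **Existence of `s₊`**: every null-homologous model knot has an `s₊` (apply existence of `s₋`
to the mirrored knot, which is again a null-homologous model knot). [cite: ManolescuMarengonSarkarWillis2023, Thm. 1.4 and Def. 8.1] -/
theorem exists_hasSPlus (hgp : exists_isModelIsotopic_wC_ne_zero)
    (hev : eventually_approxHasRasmussen) {K : 𝕊 1 → 𝔼 4} (hK : IsModelKnot r K)
    (h0 : IsNullHomologous r K) : ∃ s, HasSPlus r K s := by
  obtain ⟨s, hs⟩ := exists_hasSMinus hgp hev hK.modelMirror_comp h0.modelMirror_comp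
  exact ⟨-s, by rwa [hasSPlus_iff, neg_neg]⟩

/-- **`s₊(K)` is well defined** for null-homologous model knots. [cite: ManolescuMarengonSarkarWillis2023, Thm. 1.3 and Def. 8.1] -/
theorem existsUnique_hasSPlus (hgp : exists_isModelIsotopic_wC_ne_zero)
    (hev : eventually_approxHasRasmussen) (huniq : hasSMinus_unique) {K : 𝕊 1 → 𝔼 4}
    (hK : IsModelKnot r K) (h0 : IsNullHomologous r K) : ∃! s, HasSPlus r K s := by
  obtain ⟨s, hs⟩ := exists_hasSPlus hgp hev hK h0
  exact ⟨s, hs, fun s' hs' ↦ hs'.unique huniq hs⟩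

/-! ## Slice discs for model knots, in the complement of `D_r` and inside `D_r` -/

/-- **A slice disc for the model knot `K ⊂ ∂D_r` in the complement of the dotted handlebody,
inside an ambient `4`-manifold `X`** — word for word the disc clause of the route
`SmoothPoincare4/DottedCircleRasmussen` (items `DcrGap`, `DcrRigidity`, …), and the analogue of
`Knot.IsSliceDiscIn` (`HomotopyBallSlice`) with the closed unit ball replaced by
`D_r = modelHandlebody r`: `e : ℝ⁴ → X` is a smooth embedding (carrying the model), and
`f : ℝ² → X` restricted to the closed unit disc `𝔻²` is a smooth embedded disc (`C^∞`, injective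
and immersive on `𝔻²`) whose interior misses `e(D_r)` and whose boundary circle is `e ∘ K`.
For `X ≅ S⁴` and `e` standard, `X ∖ e(D_r°) ≅ ♮ʳ(B² × S²)` and this is a slice disc in the sense
of [MMSW, Def. 8.14] (genus `0`). [cite: ManolescuMarengonSarkarWillis2023, Def. 8.14] -/
def IsSliceDiscInComplement (r : ℕ) (K : 𝕊 1 → 𝔼 4) (X : Type*) [TopologicalSpace X]
    [ChartedSpace (𝔼 4) X] (e : 𝔼 4 → X) (f : 𝔼 2 → X) : Prop :=
  Manifold.IsSmoothEmbedding (𝓡 4) (𝓡 4) ∞ e ∧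
    ContMDiff (𝓡 2) (𝓡 4) ∞ f ∧ InjOn f 𝔻² ∧
    (∀ x ∈ 𝔻², Injective (mfderiv (𝓡 2) (𝓡 4) f x)) ∧
    (∀ x : 𝔼 2, ‖x‖ < 1 → f x ∉ e '' modelHandlebody r) ∧
    ∀ t : 𝕊 1, f t = e (K t)

/-- `IsSliceDiscInComplement` unfolded to the literal conjunction of the route's items (the
handlebody as the set `{guard ∧ G_r ≤ 1}`). [folklore] -/
theorem isSliceDiscInComplement_iff (K : 𝕊 1 → 𝔼 4) (X : Type*) [TopologicalSpace X]
    [ChartedSpace (𝔼 4) X] (e : 𝔼 4 → X) (f : 𝔼 2 → X) :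
    IsSliceDiscInComplement r K X e f ↔
      Manifold.IsSmoothEmbedding (𝓡 4) (𝓡 4) ∞ e ∧
        ContMDiff (𝓡 2) (𝓡 4) ∞ f ∧ InjOn f 𝔻² ∧
        (∀ x ∈ 𝔻², Injective (mfderiv (𝓡 2) (𝓡 4) f x)) ∧
        (∀ x : 𝔼 2, ‖x‖ < 1 → f x ∉ e '' {x : 𝔼 4 |
          (∀ j : Fin r, (1 : ℝ) ≤ (x 0 - 4 * (((j : ℕ) : ℝ) + 1)) ^ 2 + (x 1) ^ 2) ∧
          ((x 0) ^ 2 + (x 1) ^ 2) / (40 * ((r : ℝ) + 1)) ^ 2 +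
              (∑ j : Fin r, 1 / ((x 0 - 4 * (((j : ℕ) : ℝ) + 1)) ^ 2 + (x 1) ^ 2)) +
            (x 2) ^ 2 + (x 3) ^ 2 ≤ 1}) ∧
        ∀ t : 𝕊 1, f t = e (K t) :=
  Iff.rfl

/-- **A slice disc for `K` in the model `2`-handlebody filling `W_r = ℝ⁴ ∖ D_r° (∪ ∞) ≅ ♮ʳ(B² × S²)`
of `M_r`**: the case `X = ℝ⁴`, `e = id` of `IsSliceDiscInComplement` — `f|_{𝔻²}` a smooth
embedded disc in `ℝ⁴` with interior outside `D_r` and boundary `K ⊂ ∂D_r`.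
[cite: ManolescuMarengonSarkarWillis2023, Def. 8.14] -/
def IsModelSliceDisc (r : ℕ) (K : 𝕊 1 → 𝔼 4) (f : 𝔼 2 → 𝔼 4) : Prop :=
  ContMDiff (𝓡 2) (𝓡 4) ∞ f ∧ InjOn f 𝔻² ∧
    (∀ x ∈ 𝔻², Injective (mfderiv (𝓡 2) (𝓡 4) f x)) ∧
    (∀ x : 𝔼 2, ‖x‖ < 1 → f x ∉ modelHandlebody r) ∧ ∀ t : 𝕊 1, f t = K t

/-- **A slice disc for `K` inside the model `1`-handlebody `D_r ≅ ♮ʳ(S¹ × B³)`**: `f|_{𝔻²}` a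
smooth embedded disc with interior in the interior `D_r° = modelInterior r` and boundary
`K ⊂ ∂D_r` — a genus-`0` surface of [MMSW, Def. 8.13]. [cite: ManolescuMarengonSarkarWillis2023, Def. 8.13] -/
def IsInnerSliceDisc (r : ℕ) (K : 𝕊 1 → 𝔼 4) (f : 𝔼 2 → 𝔼 4) : Prop :=
  ContMDiff (𝓡 2) (𝓡 4) ∞ f ∧ InjOn f 𝔻² ∧
    (∀ x ∈ 𝔻², Injective (mfderiv (𝓡 2) (𝓡 4) f x)) ∧
    (∀ x : 𝔼 2, ‖x‖ < 1 → f x ∈ modelInterior r) ∧ ∀ t : 𝕊 1, f t = K t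

/-- The model slice disc predicate is the case `X = ℝ⁴`, `e = id` of the general one. [folklore] -/
theorem isSliceDiscInComplement_id_iff (K : 𝕊 1 → 𝔼 4) (f : 𝔼 2 → 𝔼 4) :
    IsSliceDiscInComplement r K (𝔼 4) id f ↔ IsModelSliceDisc r K f := by
  constructor
  · rintro ⟨-, hf, hinj, hd, hout, hb⟩
    exact ⟨hf, hinj, hd, fun x hx hmem ↦ hout x hx ⟨f x, hmem, rfl⟩, hb⟩
  · rintro ⟨hf, hinj, hd, hout, hb⟩
    refine ⟨Manifold.IsSmoothEmbedding.id, hf, hinj, hd, fun x hx hmem ↦ ?_, hb⟩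
    obtain ⟨y, hy, hyx⟩ := hmem
    have hyx' : y = f x := hyx
    subst hyx'
    exact hout x hx hy

/-- The boundary of a model slice disc is the knot. [folklore] -/
theorem IsModelSliceDisc.apply_sphere {K : 𝕊 1 → 𝔼 4} {f : 𝔼 2 → 𝔼 4}
    (h : IsModelSliceDisc r K f) (t : 𝕊 1) : f t = K t :=
  h.2.2.2.2 t

/-- The interior of a model slice disc misses the handlebody `D_r`. [folklore] -/
theorem IsModelSliceDisc.apply_notMem {K : 𝕊 1 → 𝔼 4} {f : 𝔼 2 → 𝔼 4}
    (h : IsModelSliceDisc r K f) {x : 𝔼 2} (hx : ‖x‖ < 1) : f x ∉ modelHandlebody r :=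
  h.2.2.2.1 x hx

/-- The interior of an inner slice disc lies in `D_r°`. [folklore] -/
theorem IsInnerSliceDisc.apply_mem {K : 𝕊 1 → 𝔼 4} {f : 𝔼 2 → 𝔼 4}
    (h : IsInnerSliceDisc r K f) {x : 𝔼 2} (hx : ‖x‖ < 1) : f x ∈ modelInterior r :=
  h.2.2.2.1 x hx

/-- The mirror preserves the model handlebody `D_r`. [folklore] -/
theorem modelMirror_mem_modelHandlebody_iff (x : 𝔼 4) :
    modelMirror x ∈ modelHandlebody r ↔ x ∈ modelHandlebody r := by
  simp [mem_modelHandlebody_iff]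

/-- The mirror preserves the model interior `D_r°`. [folklore] -/
theorem modelMirror_mem_modelInterior_iff (x : 𝔼 4) :
    modelMirror x ∈ modelInterior r ↔ x ∈ modelInterior r := by
  simp [mem_modelInterior_iff]

/-- The differential of `ρ ∘ f` is injective where that of `f` is (`ρ` is a linear
automorphism of `ℝ⁴`). [folklore] -/
theorem injective_mfderiv_modelMirror_comp {f : 𝔼 2 → 𝔼 4} (hf : ContMDiff (𝓡 2) (𝓡 4) ∞ f)
    {x : 𝔼 2} (hx : Injective (mfderiv (𝓡 2) (𝓡 4) f x)) :
    Injective (mfderiv (𝓡 2) (𝓡 4) (modelMirror ∘ f) x) := by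
  have h1 : MDifferentiableAt 𝓘(ℝ, 𝔼 4) 𝓘(ℝ, 𝔼 4) modelMirror (f x) :=
    contMDiff_modelMirror.mdifferentiableAt (by simp)
  have h2 : MDifferentiableAt (𝓡 2) (𝓡 4) f x := hf.mdifferentiableAt (by simp)
  have hm : mfderiv 𝓘(ℝ, 𝔼 4) 𝓘(ℝ, 𝔼 4) modelMirror (f x) = (mirrorEquiv : 𝔼 4 →L[ℝ] 𝔼 4) := by
    rw [mfderiv_eq_fderiv]
    exact (mirrorEquiv : 𝔼 4 →L[ℝ] 𝔼 4).fderiv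
  rw [mfderiv_comp x h1 h2, hm]
  exact mirrorEquiv.injective.comp hx

/-- **The mirror of a model slice disc is a model slice disc for the mirrored knot** (`ρ` is a
linear automorphism of `ℝ⁴` preserving `D_r`). [folklore] -/
theorem IsModelSliceDisc.modelMirror_comp {K : 𝕊 1 → 𝔼 4} {f : 𝔼 2 → 𝔼 4}
    (h : IsModelSliceDisc r K f) : IsModelSliceDisc r (modelMirror ∘ K) (modelMirror ∘ f) := by
  obtain ⟨hf, hinj, hd, hout, hb⟩ := h
  refine ⟨contMDiff_modelMirror.comp hf, modelMirror_injective.comp_injOn hinj,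
    fun x hx ↦ injective_mfderiv_modelMirror_comp hf (hd x hx), fun x hx hmem ↦ hout x hx ?_,
    fun t ↦ by simp [hb t]⟩
  exact (modelMirror_mem_modelHandlebody_iff (f x)).1 hmem

/-- The mirror of an inner slice disc is an inner slice disc for the mirrored knot. [folklore] -/
theorem IsInnerSliceDisc.modelMirror_comp {K : 𝕊 1 → 𝔼 4} {f : 𝔼 2 → 𝔼 4}
    (h : IsInnerSliceDisc r K f) : IsInnerSliceDisc r (modelMirror ∘ K) (modelMirror ∘ f) := by
  obtain ⟨hf, hinj, hd, hin, hb⟩ := h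
  exact ⟨contMDiff_modelMirror.comp hf, modelMirror_injective.comp_injOn hinj,
    fun x hx ↦ injective_mfderiv_modelMirror_comp hf (hd x hx),
    fun x hx ↦ (modelMirror_mem_modelInterior_iff (f x)).2 (hin x hx), fun t ↦ by simp [hb t]⟩

/-! ## The genus bounds of MMSW Thm. 1.15 for knots bounding discs (named facts) -/

/-- **MMSW Lemma 8.19 for a knot bounding a disc in `♮ʳ(B² × S²)`, in the model.** If the
null-homologous knot `K ⊂ M_r = ∂D_r` has `s₋(K) = s` and bounds a smooth proper disc in the
complement `ℝ⁴ ∖ D_r° ⊂ S⁴ ∖ D_r° ≅ ♮ʳ(B² × S²)` of the dotted handlebody, then `s ≤ 0`.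
[MMSW, Lemma 8.19]: for a null-homologous `ℓ`-component link `L ⊂ #ʳ(S¹ × S²)` and a properly
embedded surface `Σ ⊂ ♮ʳ(B² × S²)` with `σ` components, none closed, `∂Σ = L`:
`s₋(L) ≤ 1 - χ(Σ) = 2g(Σ) + ℓ - 2σ + 1`; here `ℓ = σ = 1`, `g = 0`.  The identification
`S⁴ ∖ D_r° ≅ ♮ʳ(B² × S²)` (the `4`-ball `S⁴ ∖ D̂°` with `r` `0`-framed `2`-handles along the unlink
of fibre circles over the hole centres) is [Kirby1989, Ch. I §2]; its restriction to the
boundary differs from MMSW's by a self-diffeomorphism of `M_r` which, after composing with the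
model reflection `ρ` (preserving `D_r`) if needed, is orientation-preserving, and `s₋` is
invariant under those [MMSW, Thm. 2.8] — see the module docstring; so the bound holds for the
disc as given AND for its reflection (`sPlus_nonneg_of_isModelSliceDisc`).
`-- TODO(general form): genus-g surfaces with σ components bounding ℓ-component links.`
[cite: ManolescuMarengonSarkarWillis2023, Lemma 8.19] -/
def sMinus_nonpos_of_isModelSliceDisc : Prop :=
  ∀ {r : ℕ} {K : 𝕊 1 → 𝔼 4} {s : ℤ} {f : 𝔼 2 → 𝔼 4} (_h : HasSMinus r K s)
    (_hf : IsModelSliceDisc r K f), s ≤ 0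

/-- **MMSW Thm. 1.15 (= Thm. 8.16) for a knot bounding a disc in `♮ʳ(S¹ × B³)`, in the model.**
If the null-homologous knot `K ⊂ M_r = ∂D_r` has `s₊(K) = s` and bounds a smooth proper disc
inside the dotted handlebody `D_r ≅ ♮ʳ(S¹ × B³)` (MMSW's first filling, `M_r` oriented as its
boundary — the convention of `MMSWRasmussen`), then `s ≤ 0`.  [MMSW, Thm. 8.16]:
`s₊(L) ≤ 2 g_{S¹×B³}(L) + ℓ - 1` for a non-empty null-homologous `ℓ`-component link, with
`g_{S¹×B³}` the minimal genus of a properly embedded oriented surface in `♮ʳ(S¹ × B³)` bounded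
by `L` [Def. 8.13]; here `ℓ = 1`, `g = 0` (via Lemma 8.20 such a disc isotopes into
`I × M_r`, a concordance to the unknot).
`-- TODO(general form): genus-g oriented surfaces bounding ℓ-component links.`
[cite: ManolescuMarengonSarkarWillis2023, Thm. 1.15 and Def. 8.13] -/
def sPlus_nonpos_of_isInnerSliceDisc : Prop :=
  ∀ {r : ℕ} {K : 𝕊 1 → 𝔼 4} {s : ℤ} {f : 𝔼 2 → 𝔼 4} (_h : HasSPlus r K s)
    (_hf : IsInnerSliceDisc r K f), s ≤ 0

/-! ### Consequences: the slice windows -/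

/-- **`0 ≤ s₊(K)` for a knot sliced in the complement of `D_r`**: the reflection `ρ ∘ f` is a
slice disc for `ρ ∘ K` in the complement, so `s₋(ρ ∘ K) ≤ 0` by Lemma 8.19, and
`s₊(K) = -s₋(ρ ∘ K)`. [cite: ManolescuMarengonSarkarWillis2023, Lemma 8.19 and Prop. 8.8 (1)] -/
theorem sPlus_nonneg_of_isModelSliceDisc (h19 : sMinus_nonpos_of_isModelSliceDisc)
    {K : 𝕊 1 → 𝔼 4} {s : ℤ} {f : 𝔼 2 → 𝔼 4} (h : HasSPlus r K s)
    (hf : IsModelSliceDisc r K f) : 0 ≤ s := by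
  have := h19 h hf.modelMirror_comp
  omega

/-- **The slice window in the complement (model form of the GFGMW lemma of the route
`DottedCircleRasmussen`)**: a null-homologous knot `K ⊂ ∂D_r` with `s₋(K) = s₁`, `s₊(K) = s₂`
that bounds a smooth proper disc in `ℝ⁴ ∖ D_r°` satisfies `s₁ ≤ 0 ≤ s₂`.  For `r = 0`
(`D_0 = B⁴`) this is Rasmussen's `s(K) = 0` for slice `K`. [cite: ManolescuMarengonSarkarWillis2023, Lemma 8.19] -/
theorem sMinus_nonpos_sPlus_nonneg_of_isModelSliceDisc (h19 : sMinus_nonpos_of_isModelSliceDisc)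
    {K : 𝕊 1 → 𝔼 4} {s₁ s₂ : ℤ} {f : 𝔼 2 → 𝔼 4} (h₁ : HasSMinus r K s₁) (h₂ : HasSPlus r K s₂)
    (hf : IsModelSliceDisc r K f) : s₁ ≤ 0 ∧ 0 ≤ s₂ :=
  ⟨h19 h₁ hf, sPlus_nonneg_of_isModelSliceDisc h19 h₂ hf⟩

/-- **`0 ≤ s₋(K)` for a knot sliced inside `D_r`**: reflect, `s₊(ρ ∘ K) = -s₋(K) ≤ 0`.
[cite: ManolescuMarengonSarkarWillis2023, Thm. 1.15 and Prop. 8.8 (1)] -/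
theorem sMinus_nonneg_of_isInnerSliceDisc (h16 : sPlus_nonpos_of_isInnerSliceDisc)
    {K : 𝕊 1 → 𝔼 4} {s : ℤ} {f : 𝔼 2 → 𝔼 4} (h : HasSMinus r K s)
    (hf : IsInnerSliceDisc r K f) : 0 ≤ s := by
  have := h16 ((hasSMinus_iff_hasSPlus_modelMirror K s).1 h) hf.modelMirror_comp
  omega

/-- **A knot sliced inside `D_r ≅ ♮ʳ(S¹ × B³)` has `s₋ = s₊ = 0`**: `0 ≤ s₋ ≤ s₊ ≤ 0`
(MMSW: such a disc isotopes into `I × M_r`, Lemma 8.20, a concordance to the unknot, and `s_±`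
are concordance invariants, Cor. 8.11). [cite: ManolescuMarengonSarkarWillis2023, Thm. 1.15 and Prop. 8.8 (5)] -/
theorem sMinus_eq_zero_of_isInnerSliceDisc (h16 : sPlus_nonpos_of_isInnerSliceDisc)
    (h88 : sMinus_le_sPlus) {K : 𝕊 1 → 𝔼 4} {s₁ s₂ : ℤ} {f : 𝔼 2 → 𝔼 4}
    (h₁ : HasSMinus r K s₁) (h₂ : HasSPlus r K s₂) (hf : IsInnerSliceDisc r K f) :
    s₁ = 0 ∧ s₂ = 0 := by
  have ha := sMinus_nonneg_of_isInnerSliceDisc h16 h₁ hf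
  have hb := h88 h₁ h₂
  have hc := h16 h₂ hf
  omega

end MMSW

/-! ## The bundled invariant -/

/-- **The Manolescu–Marengon–Sarkar–Willis invariants of a knot in `#ʳ(S¹ × S²)`.** For a model
knot `K ⊂ M_r = ∂D_r` (the explicit model of `#ʳ(S¹ × S²)` of `MMSWRasmussen`), a term of
`MMSWRasmussen r K` is the pair of integers `s₋(K)` (`sMinus`, MMSW's `s₋(L) = s(L)`) and
`s₊(K)` (`sPlus`, MMSW's `s₊(L) = -s(-L)`) together with their defining certificates
`MMSW.HasSMinus r K sMinus`, `MMSW.HasSPlus r K sPlus` [MMSW, Def. 3.1, Def. 8.1, computed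
through finite approximation, Prop. 8.2].  The type is inhabited exactly when `K` is a
null-homologous model knot (`nonempty_iff`, from MMSW Thm. 1.4) and is a subsingleton
(`subsingleton`, from MMSW Thm. 1.3): "the" MMSW invariants of `K`.  Route items quantify over
it: `∀ w : MMSWRasmussen k K₀, w.sMinus ≤ 0 ∧ 0 ≤ w.sPlus` (GFGMW window),
`∃ w : MMSWRasmussen k K₀, 0 < w.sMinus ∨ w.sPlus < 0` (a certificate).
[cite: ManolescuMarengonSarkarWillis2023, Def. 8.1] -/
structure MMSWRasmussen (r : ℕ) (K : 𝕊 1 → 𝔼 4) where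
  /-- The invariant `s₋(K) = s(K) ∈ ℤ`. -/
  sMinus : ℤ
  /-- The invariant `s₊(K) = -s(-K) ∈ ℤ`. -/
  sPlus : ℤ
  /-- Certificate that `s₋(K) = sMinus`. -/
  hasSMinus : MMSW.HasSMinus r K sMinus
  /-- Certificate that `s₊(K) = sPlus`. -/
  hasSPlus : MMSW.HasSPlus r K sPlus

namespace MMSWRasmussen

variable {r : ℕ} {K K' : 𝕊 1 → 𝔼 4}

/-- A knot with MMSW invariants is a model knot. [cite: ManolescuMarengonSarkarWillis2023, Def. 8.1] -/
theorem isModelKnot (w : MMSWRasmussen r K) : MMSW.IsModelKnot r K :=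
  w.hasSMinus.isModelKnot

/-- A knot with MMSW invariants is null-homologous in `M_r`. [cite: ManolescuMarengonSarkarWillis2023, Def. 8.1] -/
theorem isNullHomologous (w : MMSWRasmussen r K) : MMSW.IsNullHomologous r K :=
  w.hasSMinus.isNullHomologous

/-- **Uniqueness**: any two MMSW-invariant data of the same knot coincide (MMSW Thm. 1.3, as the
fact `MMSW.hasSMinus_unique`). [cite: ManolescuMarengonSarkarWillis2023, Thm. 1.3] -/
theorem eq_of_unique (huniq : MMSW.hasSMinus_unique) (w w' : MMSWRasmussen r K) : w = w' := by
  obtain ⟨a, b, ha, hb⟩ := w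
  obtain ⟨a', b', ha', hb'⟩ := w'
  obtain rfl : a = a' := ha.unique huniq ha'
  obtain rfl : b = b' := hb.unique huniq hb'
  rfl

/-- The type of MMSW invariants of a knot is a subsingleton (MMSW Thm. 1.3).
[cite: ManolescuMarengonSarkarWillis2023, Thm. 1.3] -/
theorem subsingleton (huniq : MMSW.hasSMinus_unique) : Subsingleton (MMSWRasmussen r K) :=
  ⟨eq_of_unique huniq⟩

/-- **Existence**: exactly the null-homologous model knots have MMSW invariants (MMSW Thm. 1.4
with general position, as the facts `MMSW.exists_isModelIsotopic_wC_ne_zero`,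
`MMSW.eventually_approxHasRasmussen`). [cite: ManolescuMarengonSarkarWillis2023, Thm. 1.4 and Def. 8.1] -/
theorem nonempty_iff (hgp : MMSW.exists_isModelIsotopic_wC_ne_zero)
    (hev : MMSW.eventually_approxHasRasmussen) :
    Nonempty (MMSWRasmussen r K) ↔ MMSW.IsModelKnot r K ∧ MMSW.IsNullHomologous r K := by
  refine ⟨fun ⟨w⟩ ↦ ⟨w.isModelKnot, w.isNullHomologous⟩, fun ⟨hK, h0⟩ ↦ ?_⟩
  obtain ⟨a, ha⟩ := MMSW.exists_hasSMinus hgp hev hK h0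
  obtain ⟨b, hb⟩ := MMSW.exists_hasSPlus hgp hev hK h0
  exact ⟨⟨a, b, ha, hb⟩⟩

/-- **Isotopy invariance**: the MMSW invariants of `K` are MMSW invariants of every knot isotopic
to `K` in `M_r`. [cite: ManolescuMarengonSarkarWillis2023, Thm. 1.3] -/
def ofIsModelIsotopic (w : MMSWRasmussen r K) (h : MMSW.IsModelIsotopic r K K') :
    MMSWRasmussen r K' :=
  ⟨w.sMinus, w.sPlus, w.hasSMinus.of_isModelIsotopic h, w.hasSPlus.of_isModelIsotopic h⟩

/-- Isotopy does not change `s₋`. [cite: ManolescuMarengonSarkarWillis2023, Thm. 1.3] -/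
@[simp] theorem sMinus_ofIsModelIsotopic (w : MMSWRasmussen r K)
    (h : MMSW.IsModelIsotopic r K K') : (w.ofIsModelIsotopic h).sMinus = w.sMinus :=
  rfl

/-- Isotopy does not change `s₊`. [cite: ManolescuMarengonSarkarWillis2023, Thm. 1.3] -/
@[simp] theorem sPlus_ofIsModelIsotopic (w : MMSWRasmussen r K)
    (h : MMSW.IsModelIsotopic r K K') : (w.ofIsModelIsotopic h).sPlus = w.sPlus :=
  rfl

/-- **Mirror rule `s_±(ρK) = -s_∓(K)`** (MMSW Prop. 8.8 (1): `s_±(m(L)) = -s_∓(L)`, with the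
model reflection `ρ` for `m`). [cite: ManolescuMarengonSarkarWillis2023, Prop. 8.8 (1)] -/
def modelMirror (w : MMSWRasmussen r K) : MMSWRasmussen r (MMSW.modelMirror ∘ K) :=
  ⟨-w.sPlus, -w.sMinus, w.hasSPlus, (MMSW.hasSMinus_iff_hasSPlus_modelMirror K _).1 w.hasSMinus⟩

/-- `s₋(ρK) = -s₊(K)`. [cite: ManolescuMarengonSarkarWillis2023, Prop. 8.8 (1)] -/
@[simp] theorem sMinus_modelMirror (w : MMSWRasmussen r K) : w.modelMirror.sMinus = -w.sPlus :=
  rfl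

/-- `s₊(ρK) = -s₋(K)`. [cite: ManolescuMarengonSarkarWillis2023, Prop. 8.8 (1)] -/
@[simp] theorem sPlus_modelMirror (w : MMSWRasmussen r K) : w.modelMirror.sPlus = -w.sMinus :=
  rfl

/-- **`s₋(K) ≤ s₊(K)`** (MMSW Prop. 8.8 (5) / Thm. 1.15, as the fact `MMSW.sMinus_le_sPlus`).
[cite: ManolescuMarengonSarkarWillis2023, Thm. 1.15] -/
theorem sMinus_le_sPlus (h88 : MMSW.sMinus_le_sPlus) (w : MMSWRasmussen r K) :
    w.sMinus ≤ w.sPlus :=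
  h88 w.hasSMinus w.hasSPlus

/-- **The GFGMW window in the model**: a knot with MMSW invariants that bounds a smooth proper
disc in `ℝ⁴ ∖ D_r°` has `s₋ ≤ 0 ≤ s₊` (from the fact `MMSW.sMinus_nonpos_of_isModelSliceDisc`,
Lemma 8.19, and its mirror). [cite: ManolescuMarengonSarkarWillis2023, Lemma 8.19] -/
theorem sMinus_nonpos_sPlus_nonneg (h19 : MMSW.sMinus_nonpos_of_isModelSliceDisc)
    (w : MMSWRasmussen r K) {f : 𝔼 2 → 𝔼 4} (hf : MMSW.IsModelSliceDisc r K f) :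
    w.sMinus ≤ 0 ∧ 0 ≤ w.sPlus :=
  MMSW.sMinus_nonpos_sPlus_nonneg_of_isModelSliceDisc h19 w.hasSMinus w.hasSPlus hf

/-- A knot with MMSW invariants that bounds a smooth proper disc inside `D_r` has
`s₋ = s₊ = 0` (facts `MMSW.sPlus_nonpos_of_isInnerSliceDisc`, `MMSW.sMinus_le_sPlus`).
[cite: ManolescuMarengonSarkarWillis2023, Thm. 1.15] -/
theorem sMinus_eq_zero_sPlus_eq_zero (h16 : MMSW.sPlus_nonpos_of_isInnerSliceDisc)
    (h88 : MMSW.sMinus_le_sPlus) (w : MMSWRasmussen r K) {f : 𝔼 2 → 𝔼 4}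
    (hf : MMSW.IsInnerSliceDisc r K f) : w.sMinus = 0 ∧ w.sPlus = 0 :=
  MMSW.sMinus_eq_zero_of_isInnerSliceDisc h16 h88 w.hasSMinus w.hasSPlus hf

end MMSWRasmussen

end Literature.Topology.FourManifolds

end
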